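import Literature.Probability.RandomPlanarGeometry.SLESixHullLocalityAlive
import Literature.Probability.RandomPlanarGeometry.SLEImageBM
import HarnessLib

/-!
# The tilted [LSW] Theorem 6.5 (line `boundary-area-law`, RS5b): locality of the image curve under a tilted probability

Line `boundary-area-law` of the crux `SubseqIdentification` (stmt-CriticalPhenomena-0783), restriction
reshape (lead c4, r-c4-3), stub RS5b `stub_thm65Tilted` (the Girsanov reading of G. F. Lawler,
O. Schramm, W. Werner, *Conformal restriction: the chordal case*, J. Amer. Math. Soc. 16 (2003),
Prop. 5.3 with §5: under the tilted probability `Q̄_A = (Y_∞ / Φ_A′(0)^α) · P` the curve `E_A ∘ γ`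
IS an SLE_κ). Milestone (T5) of the plan `RS5b-PLAN.md`: **the probabilistic assembly for an
arbitrary probability measure `Q ≪ P` on the canonical space**, verbatim the tree's
`sle_six_hull_locality_alive_of_imageBM` (Lawler–Schramm–Werner (2001) Thm. 2.2 at `κ = 6`,
`Q = P`) with the measure and `κ` made parameters:

* `sle_hull_locality_of_imageBM_of_ac` — for `0 < κ ≠ 8`, a nonempty `A ∈ 𝒬*`, a probability measure
  `Q ≪ P` on the canonical space, GIVEN (BM_Q) at every level `n` a real Brownian motion `Bc` on
  `(Ω × Ω, Q ⊗ P)` with `√κ · Bc s = Loewner.imageDriverC W A T₀ s` for `s ≤ σ(T₀)` whenever the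
  localising time `T₀ = imgLocTimeK κ hA hne n` is positive (the output (T4) of
  `exists_sle_image_brownian_of_clock`), then for closed `S, S'` with `z ∈ S' ↔ E_A z ∈ S` off `A`
  on `ℍ̄` and `Q`-a.s. alive paths at the first hit of `S'`:
  `Q {class of E_A ∘ γ stopped at S' ∈ T} = P {class of γ stopped at S ∈ T}` for Borel `T`.
  Proof = the alive assembly: the measurable path functional `G η = [traceOf η]` stopped at its first
  hit of `S`; `Z' = G(drivingPath)` `P`-a.s.; at level `m`, on `E_m = {τ_{S'} < imgLocTimeK m}` the
  chain of `Û = √κ Bc` is generated by a curve (`ae_isGeneratedByCurve_of_isBrownianReal`, `κ ≠ 8`)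
  equal to `E_A ∘ γ ∘ τ` up to `σ(τ_{S'})` (`Loewner.stoppedPathClass_starMap_eq_stopClass`,
  `firstHit_imageTrace_eq`), so `Z = G(Û)` on `E_m`; `Û` has the path law of the SLE_κ driver
  (`map_eq_map_drivingPath`), and `(Q ⊗ P)(E_mᶜ) → 0` by the exhaustion of the alive times
  (`eventually_lt_imgLocTimeK`). Every `P`-almost-sure input (Rohde–Schramm trace, the measurable
  version `τ_{S'}` of the hitting time) transfers to `Q` by absolute continuity.

References: [LSW] §5; Lawler–Schramm–Werner, Acta Math. 187 (2001) Thm. 2.2; Rohde–Schramm (2005)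
Thm. 5.1. No named fact is used.
-/

noncomputable section

open Set Filter Topology Function Complex Metric MeasureTheory ProbabilityTheory
open UpperHalfPlane (upperHalfPlaneSet)
open scoped NNReal unitInterval ENNReal
open Literature.Probability.RandomPlanarGeometry
open Literature.Probability.Process

namespace Summit.CriticalPhenomena.SAWScalingLimit.Theorems.SubseqIdentification.BoundaryAreaLaw

open Loewner
open scoped PathBorel

variable {κ : ℝ≥0} {A : Set ℂ}

/-- **Locality of the image of the SLE_κ trace under a `*`-hull, for a probability measure `Q ≪ P`
carrying the image Brownian motion** (the alive assembly of [LSW 2001] Thm. 2.2 with the measure and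
`κ` as parameters; see the module docstring). [cite: LawlerSchrammWerner2001, Thm. 2.2 (proof)] -/
theorem sle_hull_locality_of_imageBM_of_ac (hκ0 : 0 < κ) (hκ8 : κ ≠ 8) (hA : IsStarHull A) (hne : A.Nonempty)
    {Q : Measure (ℝ≥0 → ℝ)} [IsProbabilityMeasure Q] (hQP : Q ≪ preWienerMeasure)
    (hBM : ∀ n : ℕ, ∃ Bc : ℝ≥0 → (ℝ≥0 → ℝ) × (ℝ≥0 → ℝ) → ℝ,
        IsBrownianReal Bc (Q.prod preWienerMeasure) ∧
        (∀ s, Measurable (Bc s)) ∧ (∀ z, Continuous (Bc · z)) ∧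
        ∀ (z : (ℝ≥0 → ℝ) × (ℝ≥0 → ℝ)) (T₀ : ℝ≥0), imgLocTimeK κ hA hne n z.1 = T₀ → 0 < T₀ →
          ∀ s : ℝ≥0, (s : ℝ) ≤ imageClock (drvK κ (brownianCPath z.1)) A T₀ →
            Real.sqrt κ * Bc s z = imageDriverC (drvK κ (brownianCPath z.1)) A T₀ s)
    {S S' : Set ℂ} (hS : IsClosed S) (hS' : IsClosed S')
    (hdict : ∀ z : ℂ, 0 ≤ z.im → z ∉ A → (z ∈ S' ↔ starMap A z ∈ S))
    (halive : ∀ᵐ ω ∂Q, ∃ t : ℝ≥0, firstHit (sleTrace κ ω) S' = t ∧ Disjoint (closedHull (sleDriving κ ω) t) A)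
    {T : Set (CurveClass ℂ)} (hT : MeasurableSet T) :
    Q {ω | stoppedPathClass (starMap A) (sleTrace κ ω) ((firstHit (sleTrace κ ω) S').untopD 0) ∈ T} =
      preWienerMeasure {ω | stoppedPathClass id (sleTrace κ ω) ((firstHit (sleTrace κ ω) S).untopD 0) ∈ T} := by
  haveI := isProbabilityMeasure_preWienerMeasure'
  set P : Measure (ℝ≥0 → ℝ) := preWienerMeasure with hPdef
  set μ2 : Measure ((ℝ≥0 → ℝ) × (ℝ≥0 → ℝ)) := Q.prod P with hμ2
  have hfst : Measure.QuasiMeasurePreserving Prod.fst μ2 Q := Measure.quasiMeasurePreserving_fst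
  have hκne : κ ≠ 0 := hκ0.ne'
  have hgen : ∀ᵐ ω ∂P, ∃ γ, IsGeneratedByCurve (sleDriving κ ω) γ := hasSLETrace_of_ne_eight_apply hκ8
  have hgenQ : ∀ᵐ ω ∂Q, ∃ γ, IsGeneratedByCurve (sleDriving κ ω) γ := hQP.ae_le hgen
  have hWeq : ∀ ω, drvK κ (brownianCPath ω) = sleDriving κ ω := drvK_brownianCPath κ
  -- the random classes of the statement
  set Z : (ℝ≥0 → ℝ) → CurveClass ℂ := fun ω ↦ stoppedPathClass (starMap A) (sleTrace κ ω)
    ((firstHit (sleTrace κ ω) S').untopD 0) with hZ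
  set Z' : (ℝ≥0 → ℝ) → CurveClass ℂ := fun ω ↦ stoppedPathClass id (sleTrace κ ω)
    ((firstHit (sleTrace κ ω) S).untopD 0) with hZ'
  change Q {ω | Z ω ∈ T} = P {ω | Z' ω ∈ T}
  -- the path functional
  set G : C(ℝ≥0, ℝ) → CurveClass ℂ := fun η ↦ stopClass (traceOf η) ((firstHit (traceOf η) S).untopD 0)
    with hGdef
  have hGm : Measurable G := measurable_stopClass_traceOf_firstHit hS
  have hGT : MeasurableSet {η | G η ∈ T} := hGm hT
  -- (a) the plain side: `Z' = G ∘ drivingPath` a.e.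
  have hZ'G : ∀ᵐ ω ∂P, Z' ω = G (drivingPath κ ω) := by
    filter_upwards [hgen] with ω hgω
    have htr : ⇑(traceOf (drivingPath κ ω)) = sleTrace κ ω := coe_traceOf_drivingPath hgω
    show stoppedPathClass id (sleTrace κ ω) ((firstHit (sleTrace κ ω) S).untopD 0) =
      stopClass (traceOf (drivingPath κ ω)) ((firstHit (traceOf (drivingPath κ ω)) S).untopD 0)
    rw [stoppedPathClass_eq_stopClass (traceOf (drivingPath κ ω)) (fun t ↦ by rw [htr]; rfl), htr]
  have hR : P {ω | Z' ω ∈ T} = P {ω | G (drivingPath κ ω) ∈ T} := by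
    refine measure_congr ?_
    filter_upwards [hZ'G] with ω hω
    show (Z' ω ∈ T) = (G (drivingPath κ ω) ∈ T)
    rw [hω]
  -- a measurable version of the `S'`-hitting time and the exhaustion events
  obtain ⟨τS, hσst, hσeq⟩ := exists_isStoppingTime_rightCont_ae_eq_hitting
    (hasSLETrace_of_ne_eight_holds hκ8) hS'
  have hσ' : ∀ᵐ ω ∂P, τS ω = firstHit (sleTrace κ ω) S' := by
    filter_upwards [hσeq] with ω hω
    rw [hω, ← firstHit_eq_hittingAfter (fun t ω ↦ sleTrace κ ω t) S' ω]
  have hσ'Q : ∀ᵐ ω ∂Q, τS ω = firstHit (sleTrace κ ω) S' := hQP.ae_le hσ'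
  set E : ℕ → Set ((ℝ≥0 → ℝ) × (ℝ≥0 → ℝ)) := fun m ↦ {z | τS z.1 < imgLocTimeK κ hA hne m z.1} with hE
  have hEmeas : ∀ m, MeasurableSet (E m) := fun m ↦
    (measurableSet_setOf_lt_of_isStoppingTime hσst (isStoppingTime_imgLocTimeK m)).preimage measurable_fst
  have hev : ∀ᵐ z ∂μ2, ∀ᶠ m in atTop, z ∈ E m := by
    have h1 : ∀ᵐ ω ∂Q, ∀ᶠ m in atTop, τS ω < imgLocTimeK κ hA hne m ω := by
      filter_upwards [halive, hσ'Q] with ω hal hσω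
      obtain ⟨t, ht, halt⟩ := hal
      rw [hσω, ht]
      rw [← hWeq] at halt
      exact eventually_lt_imgLocTimeK hA hne halt
    exact hfst.ae h1
  have htend : Tendsto (fun m ↦ μ2 (E m)ᶜ) atTop (𝓝 0) :=
    tendsto_measure_compl_of_ae_eventually_mem hEmeas hev
  -- (b) + (c): the two-sided bound at every level
  have hL : μ2 {z | Z z.1 ∈ T} = Q {ω | Z ω ∈ T} := measure_prod_preimage_fst Q P {ω | Z ω ∈ T}
  have hbound : ∀ m, Q {ω | Z ω ∈ T} ≤ P {ω | Z' ω ∈ T} + μ2 (E m)ᶜ ∧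
      P {ω | Z' ω ∈ T} ≤ Q {ω | Z ω ∈ T} + μ2 (E m)ᶜ := by
    intro m
    obtain ⟨Bc, hBcBM, hBcm, hBcc, hagree⟩ := hBM m
    set U : (ℝ≥0 → ℝ) × (ℝ≥0 → ℝ) → ℝ≥0 → ℝ := fun z s ↦ Real.sqrt κ * Bc s z with hUdef
    set Upath : (ℝ≥0 → ℝ) × (ℝ≥0 → ℝ) → C(ℝ≥0, ℝ) := fun z ↦
      (⟨fun t ↦ Real.sqrt κ * Bc t z, continuous_const.mul (hBcc z)⟩ : C(ℝ≥0, ℝ)) with hUpath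
    have hUm : Measurable Upath :=
      Literature.Probability.Process.measurable_continuousMap_of_eval fun t ↦ (hBcm t).const_mul _
    have hlawU : μ2.map Upath = P.map (drivingPath κ) :=
      map_eq_map_drivingPath κ exists_isBrownianReal_measurable_continuous_holds hBcBM hBcc hBcm
    have hgenU : ∀ᵐ z ∂μ2, ∃ γ', IsGeneratedByCurve (U z) γ' :=
      ae_isGeneratedByCurve_of_isBrownianReal hBcBM hBcc hκne hκ8
    -- identification on `E m`
    have hB : ∀ᵐ z ∂μ2, z ∈ E m → Z z.1 = G (Upath z) := by
      filter_upwards [hgenU, hfst.ae hgenQ, hfst.ae hσ'Q, hfst.ae halive] with z hγ' hgω hσω hal hzE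
      obtain ⟨γ', hγ'⟩ := hγ'
      set ω := z.1 with hωdef
      obtain ⟨t, ht, halt⟩ := hal
      -- the localising time `T₀ > t`
      obtain ⟨T₀, hT₀⟩ := WithTop.ne_top_iff_exists.1 (imgLocTimeK_ne_top (κ := κ) (hA := hA) (hne := hne) m ω)
      have hzE' : τS ω < imgLocTimeK κ hA hne m ω := hzE
      rw [hσω, ht, ← hT₀] at hzE'
      have htT : t < T₀ := WithTop.coe_lt_coe.1 hzE'
      have hT0pos : 0 < T₀ := lt_of_le_of_lt bot_le htT
      have hT0pos' : (0 : WithTop ℝ≥0) < imgLocTimeK κ hA hne m ω := by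
        rw [← hT₀]; exact WithTop.coe_lt_coe.2 hT0pos
      have haliveT : Disjoint (closedHull (sleDriving κ ω) T₀) A := by
        have := (imgDrvP_eq_of_le (κ := κ) (hA := hA) (hne := hne) (n := m) (t := T₀) (ω := ω)
          (by rw [← hT₀]) hT0pos').1
        rwa [hWeq] at this
      have hWc : Continuous (sleDriving κ ω) := continuous_sleDriving κ ω
      have hW0 : sleDriving κ ω 0 = 0 := sleDriving_zero κ ω
      have hγgen : IsGeneratedByCurve (sleDriving κ ω) (sleTrace κ ω) := isGeneratedByCurve_trace hgω
      -- agreement of `U z` with the image driver up to `σ t ≤ σ T₀`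
      have hag : ∀ s, s ≤ clockC (sleDriving κ ω) A t → U z s = imageDriverC (sleDriving κ ω) A T₀ s := by
        intro s hs
        have hs' : (s : ℝ) ≤ imageClock (drvK κ (brownianCPath z.1)) A T₀ := by
          rw [← hωdef, hWeq]
          calc (s : ℝ) ≤ clockC (sleDriving κ ω) A t := NNReal.coe_le_coe.2 hs
            _ = imageClock (sleDriving κ ω) A t := coe_clockC hWc hA hne haliveT htT.le
            _ ≤ imageClock (sleDriving κ ω) A T₀ :=
                (strictMonoOn_imageClock hWc hA hne haliveT).monotoneOn
                  ⟨t.coe_nonneg, NNReal.coe_le_coe.2 htT.le⟩ ⟨T₀.coe_nonneg, le_rfl⟩ (NNReal.coe_le_coe.2 htT.le)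
        have h1 := hagree z T₀ (by rw [← hωdef]; exact hT₀.symm) hT0pos s hs'
        rw [← hωdef, hWeq] at h1
        exact h1
      have hU'c : Continuous (U z) := continuous_const.mul (hBcc z)
      have hγ'U : IsGeneratedByCurve (⇑(Upath z)) γ' := hγ'
      have htr : ⇑(traceOf (Upath z)) = γ' := coe_traceOf_eq hγ'U
      -- class identity and hitting dictionary (horizon `T₀`, `β₂ = t`)
      have hcls := stoppedPathClass_starMap_eq_stopClass hWc hA hne haliveT hU'c htT hag hW0 hγgen hγ'
        (traceOf (Upath z)) (fun s ↦ by rw [htr]) le_rfl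
      have hfh := firstHit_imageTrace_eq hWc hW0 hA hne haliveT hU'c htT hag hγgen hγ' hS hS' hdict ht le_rfl
      show stoppedPathClass (starMap A) (sleTrace κ ω) ((firstHit (sleTrace κ ω) S').untopD 0) =
        stopClass (traceOf (Upath z)) ((firstHit (traceOf (Upath z)) S).untopD 0)
      rw [htr, hfh, WithTop.untopD_coe, ht, WithTop.untopD_coe]
      exact hcls
    -- the law of `G (Û)`
    have hlaw : μ2 {z | G (Upath z) ∈ T} = P {ω | Z' ω ∈ T} := by
      calc μ2 {z | G (Upath z) ∈ T} = μ2.map Upath {η | G η ∈ T} := (Measure.map_apply hUm hGT).symm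
        _ = P.map (drivingPath κ) {η | G η ∈ T} := by rw [hlawU]
        _ = P {ω | G (drivingPath κ ω) ∈ T} := Measure.map_apply (measurable_drivingPath κ) hGT
        _ = P {ω | Z' ω ∈ T} := hR.symm
    constructor
    · calc Q {ω | Z ω ∈ T} = μ2 {z | Z z.1 ∈ T} := hL.symm
        _ ≤ μ2 ({z | G (Upath z) ∈ T} ∪ (E m)ᶜ) := by
            refine measure_mono_ae ?_
            filter_upwards [hB] with z hz
            intro hzT
            by_cases hzE : z ∈ E m
            · left
              show G (Upath z) ∈ T
              rw [← hz hzE]; exact hzT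
            · right; exact hzE
        _ ≤ μ2 {z | G (Upath z) ∈ T} + μ2 (E m)ᶜ := measure_union_le _ _
        _ = P {ω | Z' ω ∈ T} + μ2 (E m)ᶜ := by rw [hlaw]
    · calc P {ω | Z' ω ∈ T} = μ2 {z | G (Upath z) ∈ T} := hlaw.symm
        _ ≤ μ2 ({z | Z z.1 ∈ T} ∪ (E m)ᶜ) := by
            refine measure_mono_ae ?_
            filter_upwards [hB] with z hz
            intro hzT
            by_cases hzE : z ∈ E m
            · left
              show Z z.1 ∈ T
              rw [hz hzE]; exact hzT
            · right; exact hzE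
        _ ≤ μ2 {z | Z z.1 ∈ T} + μ2 (E m)ᶜ := measure_union_le _ _
        _ = Q {ω | Z ω ∈ T} + μ2 (E m)ᶜ := by rw [hL]
  -- let `m → ∞`
  have hlimZ' : Tendsto (fun m ↦ P {ω | Z' ω ∈ T} + μ2 (E m)ᶜ) atTop (𝓝 (P {ω | Z' ω ∈ T})) := by
    have := (tendsto_const_nhds (x := P {ω | Z' ω ∈ T})).add htend
    rwa [add_zero] at this
  have hlimZ : Tendsto (fun m ↦ Q {ω | Z ω ∈ T} + μ2 (E m)ᶜ) atTop (𝓝 (Q {ω | Z ω ∈ T})) := by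
    have := (tendsto_const_nhds (x := Q {ω | Z ω ∈ T})).add htend
    rwa [add_zero] at this
  exact le_antisymm (ge_of_tendsto' hlimZ' fun m ↦ (hbound m).1)
    (ge_of_tendsto' hlimZ fun m ↦ (hbound m).2)


/-- **(T5), registered form — locality of `E_A ∘ γ` under a probability measure `Q ≪ P` carrying the
image Brownian motion at every localisation level** (explicit-binder restatement of
`sle_hull_locality_of_imageBM_of_ac` for the stub registry of stmt-CriticalPhenomena-0783).
[cite: LawlerSchrammWerner2001, Thm. 2.2 (proof)] -/
theorem sle_hull_locality_tilted_of_imageBM :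
    ∀ (κ : ℝ≥0), 0 < κ → κ ≠ 8 → ∀ (A : Set ℂ) (hA : IsStarHull A) (hne : A.Nonempty)
      (Q : Measure (ℝ≥0 → ℝ)), IsProbabilityMeasure Q → Q ≪ preWienerMeasure →
      (∀ n : ℕ, ∃ Bc : ℝ≥0 → (ℝ≥0 → ℝ) × (ℝ≥0 → ℝ) → ℝ,
        IsBrownianReal Bc (Q.prod preWienerMeasure) ∧
        (∀ s, Measurable (Bc s)) ∧ (∀ z, Continuous (Bc · z)) ∧
        ∀ (z : (ℝ≥0 → ℝ) × (ℝ≥0 → ℝ)) (T₀ : ℝ≥0), imgLocTimeK κ hA hne n z.1 = T₀ → 0 < T₀ →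
          ∀ s : ℝ≥0, (s : ℝ) ≤ Loewner.imageClock (drvK κ (brownianCPath z.1)) A T₀ →
            Real.sqrt κ * Bc s z = Loewner.imageDriverC (drvK κ (brownianCPath z.1)) A T₀ s) →
      ∀ (S S' : Set ℂ), IsClosed S → IsClosed S' →
      (∀ z : ℂ, 0 ≤ z.im → z ∉ A → (z ∈ S' ↔ starMap A z ∈ S)) →
      (∀ᵐ ω ∂Q, ∃ t : ℝ≥0, firstHit (sleTrace κ ω) S' = t ∧ Disjoint (Loewner.closedHull (sleDriving κ ω) t) A) →
      ∀ (T : Set (CurveClass ℂ)), MeasurableSet T →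
        Q {ω | stoppedPathClass (starMap A) (sleTrace κ ω) ((firstHit (sleTrace κ ω) S').untopD 0) ∈ T} =
          preWienerMeasure {ω | stoppedPathClass id (sleTrace κ ω) ((firstHit (sleTrace κ ω) S).untopD 0) ∈ T} := by
  intro κ hκ0 hκ8 A hA hne Q hQ hQP hBM S S' hS hS' hdict halive T hT
  exact sle_hull_locality_of_imageBM_of_ac hκ0 hκ8 hA hne hQP hBM hS hS' hdict halive hT

end Summit.CriticalPhenomena.SAWScalingLimit.Theorems.SubseqIdentification.BoundaryAreaLaw

end
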